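import Mathlib
import Summits.NavierStokesRegularity.NavierStokesRegularity.Theorems.TaoLadderRungTwoFlatHopTube
import HarnessLib

/-!
# HOP-RULE GLUE 56b — referee W-18: from the EXISTENTIAL section time of the core step to a `HopRule` chosen by Hilbert's ε,
  with zone adapters (helper for the K_A♭ parent item stmt-NavierStokesRegularity-22987 `FlatGapCertificatesV2`, crux K_A♭ of
  route TaoLadderRungTwoFlat; cell harvest/h2-tao-ladder, theory-1 g44, memo numT56/HOP-RULE-GLUE-56b / LADDER §56)

PROVENANCE (p1 g23): theory-1 g44's image of record numT56/HopRuleGlue56.lean sha16 bd93feea80f4f806 (253 l., farm `lean check`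
rc 0 · 0 sorry · 0 warnings · std axioms), landed with declarations BYTE-IDENTICAL (+ two lint docstrings on the simp lemmas) except for ONE RENAMING forced by the tree:
the image's `HopTube.canonicalRule` (and its simp lemmas `canonicalRule_τ₁/_a`) is landed as `HopTube.choiceRule`
(`choiceRule_τ₁/_a`), because `HopTube.canonicalRule` is already declared in `…Theorems.TaoLadderRungTwoFlatHopTubeCanonical`
(the clamped-anchor rule for a GIVEN section-time function; `choiceRule P i₀ ε₀ θ₀ t₀ good` is that rule with the section time
CHOSEN from `good`). The image's module docstring follows with that renaming applied.

# HOP-RULE GLUE (numT56b, theory-1 g44; referee W-18): from an EXISTENTIAL section time to the CANONICAL `HopRule`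
  of theory-1's frame `…Theorems.TaoLadderRungTwoFlatHopTube` (cell harvest/h2-tao-ladder; helper shapes for item
  stmt-NavierStokesRegularity-22987 `FlatGapCertificatesV2`, crux K_A♭ of route TaoLadderRungTwoFlat)

THE POINT (W-18 of referee c85/c86). The analytic core step (`HopTube.core_hop_flat_closed[_sharp]`) delivers its
section time EXISTENTIALLY — `∃ τ₁, |τ₁ − τ| ≤ 2C_aB ∧ ∀ a > 0, budget a → CoreClause … (recentre X τ₁ a)` — while the
frame's obligations `TubeStepCore/Near/Behind/…` are stated relative to ONE rule `rule : HopRule` (functions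
`τ₁ n S`, `a n S` of the hop count and the flow). The glue is Hilbert's ε: fix any predicate `good n S t` («`t` is an
admissible checkpoint time for the flow `S` at hop `n`»), let the rule CHOOSE such a time when one exists
(`chooseTime`, by `Classical.choose`; default `t₀` otherwise) and read the ratio off the chosen time by the CLAMPED
anchor normalisation `a = max((1+ε₀)^{-θ₀}, |S_{i₀,1}(t)|/A_*)` (`clampedRatio`; the rule's docstring in …HopTube).
Then every zone obligation for `choiceRule` follows from two inputs: (∃) every hop premise admits a good time;
(∀) the zone's clause holds after re-centring at EVERY good time with the clamped ratio (`tubeStepCore_of_good`,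
`tubeStepNear_of_good`, `tubeStepBehind_of_good`, `tubeStepAhead_of_good`, `tubeStepAnchor_of_good`,
`tubeStepClock_of_good`, `tubeStepLand_of_good`). The intended `good` is `CoreGood` = «`t` in the section window and
the budgeted core landing holds at `t` for every admissible ratio» (exactly the shape of the core step's conclusion:
`exists_coreGood_iff`), so that the CORE zone picks the time and the other zones, whose estimates are uniform over the
window `|t − τ| ≤ C_w`, are evaluated there (`coreClause_of_coreGood`: the budget is needed only at the clamped ratio,
which is `≥ (1+ε₀)^{-θ₀}`, so a budget monotone in `a` is checked once at the floor — `budget_at_clampedRatio`).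

HONEST FRAMING: pure logic/bookkeeping over theory-1's typed frame; MODEL lattices only; nothing certified; no item
closed; nothing here is about the Navier–Stokes equations.
-/

noncomputable section

-- the sub-problem namespace repeats the summit name by design (D-0017)
set_option linter.dupNamespace false

namespace Summit.NavierStokesRegularity.NavierStokesRegularity.Theorems

open Set Literature.Analysis.FluidPDE Literature.Analysis.FluidPDE.TaoCascade

namespace HopTube

/-! ### 1. The ε-rule -/

open Classical in
/-- The CHOSEN checkpoint time: some `t` with `good n S t` if one exists, else the default `t₀`.
[cite: Tao2016AveragedNS, §6.4 Prop. 6.5 (the checkpoint (τ₁, μ₁) is produced existentially); cell certificate format v2, referee W-18] -/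
def chooseTime (good : ℕ → (Fin 2 → ℤ → ℝ → ℝ) → ℝ → Prop) (t₀ : ℝ) (n : ℕ) (S : Fin 2 → ℤ → ℝ → ℝ) : ℝ :=
  if h : ∃ t, good n S t then Classical.choose h else t₀

/-- The chosen time is good whenever a good time exists. [folklore (Hilbert ε / `Classical.choose_spec`)] -/
theorem chooseTime_spec {good : ℕ → (Fin 2 → ℤ → ℝ → ℝ) → ℝ → Prop} {t₀ : ℝ} {n : ℕ}
    {S : Fin 2 → ℤ → ℝ → ℝ} (h : ∃ t, good n S t) : good n S (chooseTime good t₀ n S) := by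
  unfold chooseTime
  rw [dif_pos h]
  exact Classical.choose_spec h

/-- Without a good time the rule returns the default. [folklore] -/
theorem chooseTime_of_not {good : ℕ → (Fin 2 → ℤ → ℝ → ℝ) → ℝ → Prop} {t₀ : ℝ} {n : ℕ}
    {S : Fin 2 → ℤ → ℝ → ℝ} (h : ¬ ∃ t, good n S t) : chooseTime good t₀ n S = t₀ := by
  unfold chooseTime
  rw [dif_neg h]

/-- The CLAMPED canonical ratio read off at time `t`: `a = max((1+ε₀)^{-θ₀}, |S_{i₀,1}(t)| / A_*)`.
[cite: Tao2016AveragedNS, §6.4 (re-centring ratio, statement shape); cell TRANSFER-CONSTANTS §4, LADDER §50 (clamped anchor normalisation)] -/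
def clampedRatio (P : TubeSchedule) (i₀ : Fin 2) (ε₀ θ₀ t : ℝ) (S : Fin 2 → ℤ → ℝ → ℝ) : ℝ :=
  max ((1 + ε₀) ^ (-θ₀)) (|S i₀ 1 t| / P.Astar)

/-- The clamped ratio honours the floor. [cite: Tao2016AveragedNS, §6.4 Prop. 6.5 (ratio floor); cell LADDER §50] -/
theorem floor_le_clampedRatio (P : TubeSchedule) (i₀ : Fin 2) (ε₀ θ₀ t : ℝ) (S : Fin 2 → ℤ → ℝ → ℝ) :
    (1 + ε₀) ^ (-θ₀) ≤ clampedRatio P i₀ ε₀ θ₀ t S :=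
  le_max_left _ _

/-- The clamped ratio dominates the anchor normalisation. [cite: Tao2016AveragedNS, §6.4; cell LADDER §50] -/
theorem anchor_div_le_clampedRatio (P : TubeSchedule) (i₀ : Fin 2) (ε₀ θ₀ t : ℝ) (S : Fin 2 → ℤ → ℝ → ℝ) :
    |S i₀ 1 t| / P.Astar ≤ clampedRatio P i₀ ε₀ θ₀ t S :=
  le_max_right _ _

/-- The clamped ratio is positive (`ε₀ > -1`). [cite: Tao2016AveragedNS, §6.4; cell LADDER §50] -/
theorem clampedRatio_pos (P : TubeSchedule) (i₀ : Fin 2) {ε₀ : ℝ} (hε₀ : -1 < ε₀) (θ₀ t : ℝ)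
    (S : Fin 2 → ℤ → ℝ → ℝ) : 0 < clampedRatio P i₀ ε₀ θ₀ t S :=
  lt_of_lt_of_le (Real.rpow_pos_of_pos (by linarith) _) (le_max_left _ _)

/-- After re-centring with the clamped ratio the anchor coordinate is at most `A_*` (the upper half of
`AnchorClause`, for free). [cite: Tao2016AveragedNS, §6.4; cell LADDER §50 (anchor band)] -/
theorem abs_recentre_anchor_le (P : TubeSchedule) (i₀ : Fin 2) {ε₀ : ℝ} (hε₀ : -1 < ε₀) (θ₀ t : ℝ)
    (S : Fin 2 → ℤ → ℝ → ℝ) (hA : 0 < P.Astar) :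
    |recentre S t (clampedRatio P i₀ ε₀ θ₀ t S) i₀ 0| ≤ P.Astar := by
  have ha := clampedRatio_pos P i₀ hε₀ θ₀ t S
  have h1 : |S i₀ 1 t| / P.Astar ≤ clampedRatio P i₀ ε₀ θ₀ t S := anchor_div_le_clampedRatio P i₀ ε₀ θ₀ t S
  simp only [recentre]
  rw [abs_div, abs_of_pos ha, div_le_iff₀ ha]
  have h2 : |S i₀ 1 t| ≤ clampedRatio P i₀ ε₀ θ₀ t S * P.Astar := by rwa [div_le_iff₀ hA] at h1
  simpa [add_comm, mul_comm] using h2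

/-- **The CANONICAL rule driven by a goodness predicate**: chosen time + clamped ratio at that time.
[cite: Tao2016AveragedNS, §6.4 Prop. 6.5 (statement shape); cell certificate format v2 (HopRule), referee W-18] -/
def choiceRule (P : TubeSchedule) (i₀ : Fin 2) (ε₀ θ₀ t₀ : ℝ)
    (good : ℕ → (Fin 2 → ℤ → ℝ → ℝ) → ℝ → Prop) : HopRule where
  τ₁ := fun n S => chooseTime good t₀ n S
  a := fun n S => clampedRatio P i₀ ε₀ θ₀ (chooseTime good t₀ n S) S

/-- The chosen rule's section time is the chosen time (lint docstring added at landing). [cite: Tao2016AveragedNS, §6.4 Prop. 6.5 (statement shape); cell certificate format v2, referee W-18] -/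
@[simp] theorem choiceRule_τ₁ (P : TubeSchedule) (i₀ : Fin 2) (ε₀ θ₀ t₀ : ℝ)
    (good : ℕ → (Fin 2 → ℤ → ℝ → ℝ) → ℝ → Prop) (n : ℕ) (S : Fin 2 → ℤ → ℝ → ℝ) :
    (choiceRule P i₀ ε₀ θ₀ t₀ good).τ₁ n S = chooseTime good t₀ n S := rfl

/-- The chosen rule's ratio is the clamped ratio at the chosen time (lint docstring added at landing). [cite: Tao2016AveragedNS, §6.4 Prop. 6.5 (statement shape); cell certificate format v2, referee W-18] -/
@[simp] theorem choiceRule_a (P : TubeSchedule) (i₀ : Fin 2) (ε₀ θ₀ t₀ : ℝ)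
    (good : ℕ → (Fin 2 → ℤ → ℝ → ℝ) → ℝ → Prop) (n : ℕ) (S : Fin 2 → ℤ → ℝ → ℝ) :
    (choiceRule P i₀ ε₀ θ₀ t₀ good).a n S = clampedRatio P i₀ ε₀ θ₀ (chooseTime good t₀ n S) S := rfl

/-! ### 2. Zone obligations for the canonical rule from (∃ good time) + (∀ good time, clause) -/

section Zones

variable {P : TubeSchedule} {𝕊 : Finset (ℤ × ℤ × ℤ)} {σ ε₀ : ℝ} {i₀ : Fin 2}
  {α : Fin 2 → Fin 2 → Fin 2 → ℤ × ℤ × ℤ → ℝ} {X₀ : Fin 2 → ℝ} {w : ℤ → ℝ} {r θ₀ c₀ t₀ : ℝ}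
  {ζ : ℕ → Fin 2 → ℤ → ℝ} {ustar : Fin 2 → ℤ → ℝ} {good : ℕ → (Fin 2 → ℤ → ℝ → ℝ) → ℝ → Prop} {n : ℕ}

/-- CORE obligation for the canonical rule. [cite: Tao2016AveragedNS, §6.3–6.4; cell LADDER §50.3, referee W-18] -/
theorem tubeStepCore_of_good
    (hex : ∀ z S₀ τ S F, HopPremise P 𝕊 ε₀ i₀ α X₀ w r c₀ ζ ustar n z S₀ τ S F → ∃ t, good n S t)
    (hcl : ∀ z S₀ τ S F, HopPremise P 𝕊 ε₀ i₀ α X₀ w r c₀ ζ ustar n z S₀ τ S F → ∀ t, good n S t →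
      CoreClause P i₀ ustar (n + 1) (recentre S t (clampedRatio P i₀ ε₀ θ₀ t S))) :
    TubeStepCore P (choiceRule P i₀ ε₀ θ₀ t₀ good) 𝕊 ε₀ i₀ α X₀ w r c₀ ζ ustar n := by
  intro z S₀ τ S F h
  exact hcl z S₀ τ S F h _ (chooseTime_spec (hex z S₀ τ S F h))

/-- NEAR obligation for the canonical rule. [cite: Tao2016AveragedNS, §6.3–6.4; cell LADDER §49, §50.3] -/
theorem tubeStepNear_of_good
    (hex : ∀ z S₀ τ S F, HopPremise P 𝕊 ε₀ i₀ α X₀ w r c₀ ζ ustar n z S₀ τ S F → ∃ t, good n S t)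
    (hcl : ∀ z S₀ τ S F, HopPremise P 𝕊 ε₀ i₀ α X₀ w r c₀ ζ ustar n z S₀ τ S F → ∀ t, good n S t →
      NearClause P i₀ ustar (n + 1) (recentre S t (clampedRatio P i₀ ε₀ θ₀ t S))) :
    TubeStepNear P (choiceRule P i₀ ε₀ θ₀ t₀ good) 𝕊 ε₀ i₀ α X₀ w r c₀ ζ ustar n := by
  intro z S₀ τ S F h
  exact hcl z S₀ τ S F h _ (chooseTime_spec (hex z S₀ τ S F h))

/-- BEHIND obligation for the canonical rule. [cite: Tao2016AveragedNS, §6.3–6.4; cell LADDER §50.3, §54 (R54-1)] -/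
theorem tubeStepBehind_of_good
    (hex : ∀ z S₀ τ S F, HopPremise P 𝕊 ε₀ i₀ α X₀ w r c₀ ζ ustar n z S₀ τ S F → ∃ t, good n S t)
    (hcl : ∀ z S₀ τ S F, HopPremise P 𝕊 ε₀ i₀ α X₀ w r c₀ ζ ustar n z S₀ τ S F → ∀ t, good n S t →
      BehindClause P ε₀ (n + 1) (recentre S t (clampedRatio P i₀ ε₀ θ₀ t S))) :
    TubeStepBehind P (choiceRule P i₀ ε₀ θ₀ t₀ good) 𝕊 ε₀ i₀ α X₀ w r c₀ ζ ustar n := by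
  intro z S₀ τ S F h
  exact hcl z S₀ τ S F h _ (chooseTime_spec (hex z S₀ τ S F h))

/-- AHEAD obligation for the canonical rule. [cite: Tao2016AveragedNS, §6.2 Prop. 6.3 (ix); cell LADDER §47.5 L1, §50.3] -/
theorem tubeStepAhead_of_good
    (hex : ∀ z S₀ τ S F, HopPremise P 𝕊 ε₀ i₀ α X₀ w r c₀ ζ ustar n z S₀ τ S F → ∃ t, good n S t)
    (hcl : ∀ z S₀ τ S F, HopPremise P 𝕊 ε₀ i₀ α X₀ w r c₀ ζ ustar n z S₀ τ S F → ∀ t, good n S t →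
      AheadClause P w r (recentre S t (clampedRatio P i₀ ε₀ θ₀ t S))) :
    TubeStepAhead P (choiceRule P i₀ ε₀ θ₀ t₀ good) 𝕊 ε₀ i₀ α X₀ w r c₀ ζ ustar n := by
  intro z S₀ τ S F h
  exact hcl z S₀ τ S F h _ (chooseTime_spec (hex z S₀ τ S F h))

/-- ANCHOR obligation for the canonical rule: the upper half `|z' i₀ 0| ≤ A_*` is automatic for the clamped ratio
(`abs_recentre_anchor_le`); only the deficit half `A_*(1 - γ(n+1)) ≤ |z' i₀ 0|` is an input.
[cite: Tao2016AveragedNS, §6.4; cell TRANSFER-CONSTANTS §4, LADDER §50 (anchor bookkeeping)] -/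
theorem tubeStepAnchor_of_good (hε₀ : -1 < ε₀) (hA : 0 < P.Astar)
    (hex : ∀ z S₀ τ S F, HopPremise P 𝕊 ε₀ i₀ α X₀ w r c₀ ζ ustar n z S₀ τ S F → ∃ t, good n S t)
    (hdef : ∀ z S₀ τ S F, HopPremise P 𝕊 ε₀ i₀ α X₀ w r c₀ ζ ustar n z S₀ τ S F → ∀ t, good n S t →
      P.Astar * (1 - P.γ (n + 1)) ≤ |recentre S t (clampedRatio P i₀ ε₀ θ₀ t S) i₀ 0|) :
    TubeStepAnchor P (choiceRule P i₀ ε₀ θ₀ t₀ good) 𝕊 ε₀ i₀ α X₀ w r c₀ ζ ustar n := by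
  intro z S₀ τ S F h
  have hg := chooseTime_spec (t₀ := t₀) (hex z S₀ τ S F h)
  exact ⟨hdef z S₀ τ S F h _ hg, abs_recentre_anchor_le P i₀ hε₀ θ₀ _ S hA⟩

/-- CLOCK/RATIO/SLACK obligation for the canonical rule: positivity and the floor are automatic; the clock window
`0 < t ≤ c₀` and the slack `(1+σ)·a ≤ |S_{i₀,1}(t)|` at good times are the inputs (the latter needs
`A_* ≥ 1 + σ` and a landing carrier `≥ (1+σ)(1+ε₀)^{-θ₀}`, discharged by the core/anchor estimates).
[cite: Tao2016AveragedNS, §6.4 Prop. 6.5; cell TRANSFER-CONSTANTS §4] -/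
theorem tubeStepClock_of_good (hε₀ : -1 < ε₀) (hσ : 0 ≤ σ)
    (hex : ∀ z S₀ τ S F, HopPremise P 𝕊 ε₀ i₀ α X₀ w r c₀ ζ ustar n z S₀ τ S F → ∃ t, good n S t)
    (hwin : ∀ z S₀ τ S F, HopPremise P 𝕊 ε₀ i₀ α X₀ w r c₀ ζ ustar n z S₀ τ S F → ∀ t, good n S t →
      0 < t ∧ t ≤ c₀)
    (hslack : ∀ z S₀ τ S F, HopPremise P 𝕊 ε₀ i₀ α X₀ w r c₀ ζ ustar n z S₀ τ S F → ∀ t, good n S t →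
      (1 + σ) * clampedRatio P i₀ ε₀ θ₀ t S ≤ |S i₀ 1 t|) :
    TubeStepClock P (choiceRule P i₀ ε₀ θ₀ t₀ good) 𝕊 σ ε₀ i₀ α X₀ w r θ₀ c₀ ζ ustar n := by
  intro z S₀ τ S F h
  have hg := chooseTime_spec (t₀ := t₀) (hex z S₀ τ S F h)
  obtain ⟨h1, h2⟩ := hwin z S₀ τ S F h _ hg
  have hs := hslack z S₀ τ S F h _ hg
  have ha := clampedRatio_pos P i₀ hε₀ θ₀ (chooseTime good t₀ n S) S
  refine ⟨h1, h2, ha, floor_le_clampedRatio P i₀ ε₀ θ₀ _ S, ?_, hs⟩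
  simp only [choiceRule_τ₁, choiceRule_a] at hs ⊢
  nlinarith

/-- LANDING obligation for the canonical rule from the five zone inputs at good times.
[cite: Tao2016AveragedNS, §6.3–6.4; cell LADDER §50.3] -/
theorem tubeStepLand_of_good (hε₀ : -1 < ε₀) (hA : 0 < P.Astar)
    (hex : ∀ z S₀ τ S F, HopPremise P 𝕊 ε₀ i₀ α X₀ w r c₀ ζ ustar n z S₀ τ S F → ∃ t, good n S t)
    (hdef : ∀ z S₀ τ S F, HopPremise P 𝕊 ε₀ i₀ α X₀ w r c₀ ζ ustar n z S₀ τ S F → ∀ t, good n S t →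
      P.Astar * (1 - P.γ (n + 1)) ≤ |recentre S t (clampedRatio P i₀ ε₀ θ₀ t S) i₀ 0|)
    (hcore : ∀ z S₀ τ S F, HopPremise P 𝕊 ε₀ i₀ α X₀ w r c₀ ζ ustar n z S₀ τ S F → ∀ t, good n S t →
      CoreClause P i₀ ustar (n + 1) (recentre S t (clampedRatio P i₀ ε₀ θ₀ t S)))
    (hnear : ∀ z S₀ τ S F, HopPremise P 𝕊 ε₀ i₀ α X₀ w r c₀ ζ ustar n z S₀ τ S F → ∀ t, good n S t →
      NearClause P i₀ ustar (n + 1) (recentre S t (clampedRatio P i₀ ε₀ θ₀ t S)))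
    (hbehind : ∀ z S₀ τ S F, HopPremise P 𝕊 ε₀ i₀ α X₀ w r c₀ ζ ustar n z S₀ τ S F → ∀ t, good n S t →
      BehindClause P ε₀ (n + 1) (recentre S t (clampedRatio P i₀ ε₀ θ₀ t S)))
    (hahead : ∀ z S₀ τ S F, HopPremise P 𝕊 ε₀ i₀ α X₀ w r c₀ ζ ustar n z S₀ τ S F → ∀ t, good n S t →
      AheadClause P w r (recentre S t (clampedRatio P i₀ ε₀ θ₀ t S))) :
    TubeStepLand P (choiceRule P i₀ ε₀ θ₀ t₀ good) 𝕊 ε₀ i₀ α X₀ w r c₀ ζ ustar n :=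
  tubeStepLand_of_zones P _ 𝕊 ε₀ i₀ α X₀ w r c₀ ζ ustar (tubeStepAnchor_of_good hε₀ hA hex hdef)
    (tubeStepCore_of_good hex hcore) (tubeStepNear_of_good hex hnear) (tubeStepBehind_of_good hex hbehind)
    (tubeStepAhead_of_good hex hahead)

end Zones

/-! ### 3. The intended goodness predicate: the budgeted core landing in the section window -/

/-- `CoreGood … τ Cw budget n S t`: `t` lies in the section window `|t − τ| ≤ C_w` and the BUDGETED core landing
holds at `t` for every positive ratio — verbatim the shape of the conclusion of the analytic core step
(`core_hop_flat_closed[_sharp]`: `∃ τ₁, |τ₁ − τ| ≤ 2C_aB ∧ ∀ a > 0, budget a → CoreClause … (recentre X τ₁ a)`).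
[cite: Tao2016AveragedNS, §6.3–6.4 (statement shape); cell LADDER §56 (numT56), referee W-18] -/
def CoreGood (P : TubeSchedule) (i₀ : Fin 2) (ustar : Fin 2 → ℤ → ℝ) (τ Cw : ℝ) (budget : ℕ → ℝ → Prop)
    (n : ℕ) (S : Fin 2 → ℤ → ℝ → ℝ) (t : ℝ) : Prop :=
  |t - τ| ≤ Cw ∧ ∀ a : ℝ, 0 < a → budget n a → CoreClause P i₀ ustar (n + 1) (recentre S t a)

/-- The core step's conclusion IS the existence of a good time. [cite: Tao2016AveragedNS, §6.4; cell LADDER §56] -/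
theorem exists_coreGood_iff (P : TubeSchedule) (i₀ : Fin 2) (ustar : Fin 2 → ℤ → ℝ) (τ Cw : ℝ)
    (budget : ℕ → ℝ → Prop) (n : ℕ) (S : Fin 2 → ℤ → ℝ → ℝ) :
    (∃ t, CoreGood P i₀ ustar τ Cw budget n S t) ↔
      ∃ τ₁ : ℝ, |τ₁ - τ| ≤ Cw ∧ ∀ a : ℝ, 0 < a → budget n a → CoreClause P i₀ ustar (n + 1) (recentre S τ₁ a) :=
  Iff.rfl

/-- A good time lies in the window (what the near/behind/ahead zones get to know about the chosen time).
[cite: Tao2016AveragedNS, §6.4; cell LADDER §56] -/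
theorem abs_sub_le_of_coreGood {P : TubeSchedule} {i₀ : Fin 2} {ustar : Fin 2 → ℤ → ℝ} {τ Cw : ℝ}
    {budget : ℕ → ℝ → Prop} {n : ℕ} {S : Fin 2 → ℤ → ℝ → ℝ} {t : ℝ}
    (h : CoreGood P i₀ ustar τ Cw budget n S t) : |t - τ| ≤ Cw :=
  h.1

/-- At a good time the core clause holds for the clamped ratio as soon as the budget holds AT that ratio.
[cite: Tao2016AveragedNS, §6.4; cell LADDER §56] -/
theorem coreClause_of_coreGood {P : TubeSchedule} {i₀ : Fin 2} {ustar : Fin 2 → ℤ → ℝ} {τ Cw ε₀ θ₀ : ℝ}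
    {budget : ℕ → ℝ → Prop} {n : ℕ} {S : Fin 2 → ℤ → ℝ → ℝ} {t : ℝ} (hε₀ : -1 < ε₀)
    (h : CoreGood P i₀ ustar τ Cw budget n S t) (hb : budget n (clampedRatio P i₀ ε₀ θ₀ t S)) :
    CoreClause P i₀ ustar (n + 1) (recentre S t (clampedRatio P i₀ ε₀ θ₀ t S)) :=
  h.2 _ (clampedRatio_pos P i₀ hε₀ θ₀ t S) hb

/-- A budget MONOTONE in the ratio (true of every budget of the form `LHS ≤ a · δ(n+1)` with `LHS, δ ≥ 0`) need only
be checked at the floor `(1+ε₀)^{-θ₀}`. [cite: Tao2016AveragedNS, §6.4; cell LADDER §56] -/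
theorem budget_at_clampedRatio {P : TubeSchedule} {i₀ : Fin 2} {ε₀ θ₀ : ℝ} {budget : ℕ → ℝ → Prop} {n : ℕ}
    (hmono : ∀ a a' : ℝ, a ≤ a' → budget n a → budget n a') (hfloor : budget n ((1 + ε₀) ^ (-θ₀)))
    (t : ℝ) (S : Fin 2 → ℤ → ℝ → ℝ) : budget n (clampedRatio P i₀ ε₀ θ₀ t S) :=
  hmono _ _ (floor_le_clampedRatio P i₀ ε₀ θ₀ t S) hfloor

/-- The linear budget `L n ≤ a · δ(n+1)` (the shape of `core_hop_flat_closed_sharp`'s hypothesis, `L n ≥ 0` not even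
needed when `δ ≥ 0`) is monotone in the ratio. [cite: Tao2016AveragedNS, §6.4; cell LADDER §56] -/
theorem linearBudget_mono (P : TubeSchedule) (L : ℕ → ℝ) (hδ : ∀ n, 0 ≤ P.δ n) (n : ℕ) (a a' : ℝ) (h : a ≤ a')
    (hb : L n ≤ a * P.δ (n + 1)) : L n ≤ a' * P.δ (n + 1) :=
  hb.trans (mul_le_mul_of_nonneg_right h (hδ _))

end HopTube

end Summit.NavierStokesRegularity.NavierStokesRegularity.Theorems
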